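import Mathlib
import Summits.KontsevichZagierPeriods.Zeta5Search.ClassTypeGuardsI
import Summits.KontsevichZagierPeriods.Zeta5Search.ClassTypeGuardsO
import HarnessLib

/-!
# ζ(5) search — PERIODIC CLASS-TYPE COVERS: the class-law guards are invariant under run dilation (fam-denom g14)

HONEST FRAMING: systematic search; no irrationality claim unless certified.  Cell `pub-zeta5`, family-designer seat fam-denom
(denominator arithmetic), generation 14.  Valuation combinatorics of rationals only; every kernel exponent these feed stays `< 1`.

Below `θ = p/n = 1` on an integer-slope ray (`b = n·(B₀; β)`, here the T1-map ray C1) the exponent vector of a residue class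
`x mod p` is a RUN-LENGTH WORD: one constant run per region between consecutive block end points, the run of region `r` having
depth `d_r` and length `l_r + s_r·t`, where `t` counts shifts `n ↦ n + 2p` inside a fixed `{n/p}`-cell (fam-rv g17's Rhin–Viola
translation; `RVPeriodicShift.classExp_shift`), `l_r` depends only on the cell and the residue interval, and the slope `s_r = 2Δβ_r`
does not depend on the class at all.  This file proves, ONCE AND FOR ALL `t`, that the Boolean guards of the class laws
(`checkLB`, `checkLBx`, `checkJ` = Lemma-D bonus, `checkB` = double drop, `checkI` = law A3 of `ClassTypeGuards`/`ClassTypeGuardsI`)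
evaluated on the decoded cover `RC.map (pdec t)` follow from `t`-FREE checks (`pcheckLB`, `pcheckLBx`, `pcheckJ`, `pcheckB`,
`pcheckI`) on the run data — using only FORWARD facts: sums and pole counts are affine in `t` with a common slope, a
mirror-symmetric run word decodes to a palindrome, equal run words decode to equal vectors, and the three `isRaise` shapes
(a point moved across a run boundary of depths `d, d+1`; a run split around one raised point; a leading/trailing `+1`) survive
dilation.  No converse (uniqueness of run-length encodings) is needed.  Consumers: per-cell `∀ t` window theorems on ray C1 below
`θ = 1` (one `omega` typing per residue interval via run lemmas, then `ray1_LB / ray1_J / ray1_B / ray1_I` verbatim with the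
`check* = true` hypotheses supplied by the theorems of §3).
-/

namespace Summit.KontsevichZagierPeriods.Zeta5Search.ClassTypeCover

open Summit.KontsevichZagierPeriods.Zeta5Search.SecondOrder (isRaise)
open Summit.KontsevichZagierPeriods.Zeta5Search.ClusterValuation (netExp sameKey)

/-! ## §1 Run-length words and their dilations -/

/-- A RUN `(d, l, s)`: depth `d`, base length `l`, slope `s`; at dilation parameter `t` it reads `d` repeated `l + s·t` times. -/
abbrev Run := ℤ × ℕ × ℕ

/-- Decode a run-length word at dilation parameter `t`. -/
def rdecode : List Run → ℕ → List ℤ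
  | [], _ => []
  | r :: R, t => List.replicate (r.2.1 + r.2.2 * t) r.1 ++ rdecode R t

/-- Base sum `Σ d·l`. -/
def rsum0 : List Run → ℤ
  | [] => 0
  | r :: R => r.1 * r.2.1 + rsum0 R

/-- Sum slope `Σ d·s`. -/
def rslope : List Run → ℤ
  | [] => 0
  | r :: R => r.1 * r.2.2 + rslope R

/-- Base pole count `Σ_{d<0} l`. -/
def rpoles0 : List Run → ℕ
  | [] => 0
  | r :: R => (if r.1 < 0 then r.2.1 else 0) + rpoles0 R

/-- Pole-count slope `Σ_{d<0} s`. -/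
def rpslope : List Run → ℕ
  | [] => 0
  | r :: R => (if r.1 < 0 then r.2.2 else 0) + rpslope R

/-- The empty run word decodes to the empty vector. -/
@[simp] theorem rdecode_nil (t : ℕ) : rdecode [] t = [] := rfl

/-- Decoding a run word run by run. -/
@[simp] theorem rdecode_cons (r : Run) (R : List Run) (t : ℕ) :
    rdecode (r :: R) t = List.replicate (r.2.1 + r.2.2 * t) r.1 ++ rdecode R t := rfl

/-- Decoding commutes with concatenation of run words. -/
theorem rdecode_append (R R' : List Run) (t : ℕ) : rdecode (R ++ R') t = rdecode R t ++ rdecode R' t := by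
  induction R with
  | nil => simp
  | cons r R ih => simp [ih]

/-- The reverse of a decoded run word is the decoding of the reversed run word. -/
theorem rdecode_reverse (R : List Run) (t : ℕ) : (rdecode R t).reverse = rdecode R.reverse t := by
  induction R with
  | nil => simp
  | cons r R ih => simp [rdecode_append, ih]

/-- **A mirror-symmetric run word decodes to a palindrome, at every `t`.** -/
theorem rdecode_palindrome {R : List Run} (h : R.reverse = R) (t : ℕ) : (rdecode R t).reverse = rdecode R t := by
  rw [rdecode_reverse, h]

/-- The sum of a decoded run word is affine in `t`: `rsum0 R + rslope R * t`. -/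
theorem rdecode_sum (R : List Run) (t : ℕ) : (rdecode R t).sum = rsum0 R + rslope R * t := by
  induction R with
  | nil => simp [rsum0, rslope]
  | cons r R ih =>
      simp only [rdecode_cons, List.sum_append, List.sum_replicate, nsmul_eq_mul, Nat.cast_add, Nat.cast_mul, ih, rsum0,
        rslope]
      ring

/-- `polesL` is additive under concatenation. -/
theorem polesL_append (S T : List ℤ) : polesL (S ++ T) = polesL S + polesL T := by
  simp [polesL, List.filter_append]

/-- `polesL` of a constant run: its length if the depth is negative, else `0`. -/
theorem polesL_replicate (k : ℕ) (d : ℤ) : polesL (List.replicate k d) = if d < 0 then k else 0 := by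
  by_cases h : d < 0 <;> simp [polesL, h]

/-- The pole count of a decoded run word is affine in `t`: `rpoles0 R + rpslope R * t`. -/
theorem polesL_rdecode (R : List Run) (t : ℕ) : polesL (rdecode R t) = rpoles0 R + rpslope R * t := by
  induction R with
  | nil => simp [polesL, rpoles0, rpslope]
  | cons r R ih =>
      rw [rdecode_cons, polesL_append, polesL_replicate, ih, rpoles0, rpslope]
      split_ifs <;> ring

/-- The class exponent `expL` of a decoded run word is affine in `t` (the centre correction is `t`-free). -/
theorem expL_rdecode (odd : Bool) (R : List Run) (cen : Bool) (t : ℕ) :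
    expL odd (rdecode R t) cen = (rsum0 R + if (odd && cen) = true then 1 else 0) + rslope R * t := by
  rw [expL, rdecode_sum]; ring

/-- Raising the entry at position `|A|`. -/
theorem mapIdx_raise (A B : List ℤ) (d : ℤ) :
    (A ++ d :: B).mapIdx (fun i e => if i = A.length then e + 1 else e) = A ++ (d + 1) :: B := by
  apply List.ext_getElem
  · simp
  · intro i h1 h2
    rw [List.getElem_mapIdx]
    by_cases hi : i < A.length
    · rw [List.getElem_append_left hi, List.getElem_append_left hi, if_neg (by omega)]
    · by_cases he : i = A.length
      · subst he
        rw [List.getElem_append_right (le_refl _), List.getElem_append_right (le_refl _)]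
        simp
      · have hle : A.length ≤ i := by omega
        rw [List.getElem_append_right hle, List.getElem_append_right hle, if_neg he]
        obtain ⟨k, hk⟩ : ∃ k, i - A.length = k + 1 := ⟨i - A.length - 1, by omega⟩
        simp [hk]

/-- `isRaise T S` from an explicit raised position. -/
theorem isRaise_of_split (A B : List ℤ) (d : ℤ) : isRaise (A ++ d :: B) (A ++ (d + 1) :: B) = true := by
  unfold isRaise
  rw [Bool.or_eq_true, Bool.or_eq_true, List.any_eq_true]
  exact Or.inl (Or.inl ⟨A.length, by simp, by rw [mapIdx_raise]; simp⟩)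


/-! ## §2 Periodic covers: `t`-free data of a decoded entry -/

/-- A periodic cover entry: a run word and a centre flag. -/
abbrev PRun := List Run × Bool

/-- Decode a periodic cover entry at dilation parameter `t`. -/
def pdec (t : ℕ) (rc : PRun) : List ℤ × Bool := (rdecode rc.1 t, rc.2)

/-- The self-conjugacy flag of a decoded periodic entry is `t`-free. -/
@[simp] theorem pdec_fst (t : ℕ) (rc : PRun) : (pdec t rc).1 = rdecode rc.1 t := rfl
/-- The centre component of a periodic entry is unchanged by `pdec`. -/
@[simp] theorem pdec_snd (t : ℕ) (rc : PRun) : (pdec t rc).2 = rc.2 := rfl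

/-- Base exponent of an entry (its `expL` at `t = 0`). -/
def pexp0 (odd : Bool) (rc : PRun) : ℤ := rsum0 rc.1 + if (odd && rc.2) = true then 1 else 0

/-- Pole count of a decoded periodic entry, affine in `t`. -/
theorem polesL_pdec (rc : PRun) (t : ℕ) : polesL (pdec t rc).1 = rpoles0 rc.1 + rpslope rc.1 * t :=
  polesL_rdecode _ _

/-- Class exponent of a decoded periodic entry, affine in `t`. -/
theorem expL_pdec (odd : Bool) (rc : PRun) (t : ℕ) :
    expL odd (pdec t rc).1 (pdec t rc).2 = pexp0 odd rc + rslope rc.1 * t := by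
  rw [pdec_fst, pdec_snd, expL_rdecode, pexp0]

/-- An entry with at least two poles at `t = 0` has at least two poles at every `t` (pole slopes are nonnegative). -/
theorem two_le_polesL_pdec {rc : PRun} (h : 2 ≤ rpoles0 rc.1) (t : ℕ) : 2 ≤ polesL (pdec t rc).1 := by
  rw [polesL_pdec]; exact le_trans h (Nat.le_add_right _ _)

/-- The valuation lower bound `nuL` of a decoded periodic entry, affine in `t` (given two poles at `t = 0`). -/
theorem nuL_pdec {rc : PRun} (h : 2 ≤ rpoles0 rc.1) (odd : Bool) (t : ℕ) :
    nuL odd (pdec t rc).1 (pdec t rc).2 = expL odd (pdec t rc).1 (pdec t rc).2 := by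
  have h2 := two_le_polesL_pdec h t
  unfold nuL
  rw [if_neg]
  rintro ⟨h1, -⟩
  omega

/-- Periodic droppedness: centre-free, mirror-symmetric run word, even base exponent, even slope. -/
def pdropped (odd : Bool) (σ : ℤ) (rc : PRun) : Bool :=
  !rc.2 && decide (rc.1.reverse = rc.1) && decide (Even (pexp0 odd rc)) && decide (Even σ)

/-- Periodic same-type: equal centre flags and equal or mirror-image run words. -/
def psame (rc rc' : PRun) : Bool :=
  decide (rc.2 = rc'.2) && (decide (rc.1 = rc'.1) || decide (rc.1 = rc'.1.reverse))

/-- The `t`-free drop test `pdropped` gives `droppedL` of the decoded entry at every `t`. -/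
theorem droppedL_pdec {odd : Bool} {σ : ℤ} {rc : PRun} (h : pdropped odd σ rc = true) (hσ : rslope rc.1 = σ) (t : ℕ) :
    droppedL odd (pdec t rc).1 (pdec t rc).2 = true := by
  simp only [pdropped, Bool.and_eq_true, Bool.not_eq_true', decide_eq_true_eq] at h
  obtain ⟨⟨⟨hc, hrev⟩, hev⟩, hσe⟩ := h
  have hE := expL_pdec odd rc t
  have hse : Even (rslope rc.1 * (t : ℤ)) := by rw [hσ]; exact hσe.mul_right _
  rw [droppedL, Bool.and_eq_true, Bool.and_eq_true, Bool.not_eq_true', decide_eq_true_eq, decide_eq_true_eq, hE]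
  exact ⟨⟨hc, (rdecode_palindrome hrev t).symm⟩, hev.add hse⟩

/-- Entries with `psame` run data decode to `sameTypeL` entries at every `t`. -/
theorem sameTypeL_pdec {rc rc' : PRun} (h : psame rc rc' = true) (t : ℕ) :
    sameTypeL (pdec t rc).1 (pdec t rc).2 (pdec t rc').1 (pdec t rc').2 = true := by
  simp only [psame, Bool.and_eq_true, Bool.or_eq_true, decide_eq_true_eq] at h
  obtain ⟨hc, hR⟩ := h
  rw [sameTypeL, Bool.and_eq_true, Bool.or_eq_true, decide_eq_true_eq, decide_eq_true_eq, decide_eq_true_eq,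
    pdec_fst, pdec_snd, pdec_fst, pdec_snd]
  refine ⟨hc, ?_⟩
  rcases hR with hR | hR
  · exact Or.inl (by rw [hR])
  · exact Or.inr (by rw [hR, ← rdecode_reverse])

/-! ## §3 The guards at every `t` from `t`-free checks -/

/-- `t`-free form of `checkLB` at `(A₀ + σt, B₀ + σt)`: every type multipole with sum slope `σ`, `A₀ ≤ E₀`, `B₀ ≤ 3 + E₀`. -/
def pcheckLB (odd : Bool) (RC : List PRun) (σ A₀ B₀ : ℤ) : Bool :=
  RC.all fun rc => decide (2 ≤ rpoles0 rc.1) && decide (rslope rc.1 = σ) &&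
    decide (A₀ ≤ pexp0 odd rc) && decide (B₀ ≤ 3 + pexp0 odd rc)

/-- **`checkLB` at every `t`.** -/
theorem checkLB_pdec {odd : Bool} {RC : List PRun} {σ A₀ B₀ : ℤ} (h : pcheckLB odd RC σ A₀ B₀ = true) (t : ℕ) :
    checkLB odd (RC.map (pdec t)) (A₀ + σ * t) (B₀ + σ * t) = true := by
  rw [checkLB, List.all_eq_true]
  intro tc htc
  obtain ⟨rc, hrc, rfl⟩ := List.mem_map.1 htc
  rw [pcheckLB, List.all_eq_true] at h
  have hc := h rc hrc
  simp only [Bool.and_eq_true, decide_eq_true_eq] at hc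
  obtain ⟨⟨⟨h2, hσ⟩, hA⟩, hB⟩ := hc
  have hE := expL_pdec odd rc t
  have hν := nuL_pdec h2 odd t
  rw [hσ] at hE
  simp only [Bool.and_eq_true, Bool.or_eq_true, decide_eq_true_eq]
  exact ⟨Or.inr (by rw [hν, hE]; linarith), Or.inr (by rw [hE]; linarith)⟩

/-- `t`-free form of `checkLBx` at `(m₀ + σt; A₀ + σt, B₀ + σt)`. -/
def pcheckLBx (odd : Bool) (RC : List PRun) (σ m₀ A₀ B₀ : ℤ) : Bool :=
  RC.all fun rc => decide (2 ≤ rpoles0 rc.1) && decide (rslope rc.1 = σ) &&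
    (decide (pexp0 odd rc = m₀) || (decide (A₀ ≤ pexp0 odd rc) && decide (B₀ ≤ 3 + pexp0 odd rc)))

/-- **`checkLBx` at every `t`.** -/
theorem checkLBx_pdec {odd : Bool} {RC : List PRun} {σ m₀ A₀ B₀ : ℤ} (h : pcheckLBx odd RC σ m₀ A₀ B₀ = true) (t : ℕ) :
    checkLBx odd (RC.map (pdec t)) (m₀ + σ * t) (A₀ + σ * t) (B₀ + σ * t) = true := by
  rw [checkLBx, List.all_eq_true]
  intro tc htc
  obtain ⟨rc, hrc, rfl⟩ := List.mem_map.1 htc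
  rw [pcheckLBx, List.all_eq_true] at h
  have hc := h rc hrc
  simp only [Bool.and_eq_true, Bool.or_eq_true, decide_eq_true_eq] at hc
  obtain ⟨⟨h2, hσ⟩, hx⟩ := hc
  have hE := expL_pdec odd rc t
  have hν := nuL_pdec h2 odd t
  have hP := two_le_polesL_pdec h2 t
  rw [hσ] at hE
  simp only [Bool.and_eq_true, Bool.or_eq_true, decide_eq_true_eq]
  rcases hx with hm | ⟨hA, hB⟩
  · exact Or.inl ⟨hP, by rw [hE, hm]⟩
  · exact Or.inr ⟨Or.inr (by rw [hν, hE]; linarith), Or.inr (by rw [hE]; linarith)⟩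

/-- `t`-free form of `checkJ` at `m₀ + σt`: every type multipole with sum slope `σ` and `m₀ ≤ E₀`, and every two entries
at base level `m₀` periodically dropped or periodically of the same type. -/
def pcheckJ (odd : Bool) (RC : List PRun) (σ m₀ : ℤ) : Bool :=
  RC.all fun rc => decide (2 ≤ rpoles0 rc.1) && decide (rslope rc.1 = σ) && decide (m₀ ≤ pexp0 odd rc) &&
    RC.all fun rc' => !decide (pexp0 odd rc = m₀) || !decide (pexp0 odd rc' = m₀) ||
      pdropped odd σ rc || pdropped odd σ rc' || psame rc rc'

/-- **`checkJ` (the Lemma-D bonus guard) at every `t`.** -/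
theorem checkJ_pdec {odd : Bool} {RC : List PRun} {σ m₀ : ℤ} (h : pcheckJ odd RC σ m₀ = true) (t : ℕ) :
    checkJ odd (RC.map (pdec t)) (m₀ + σ * t) = true := by
  rw [checkJ, List.all_eq_true]
  intro tc htc
  obtain ⟨rc, hrc, rfl⟩ := List.mem_map.1 htc
  have h' := h
  rw [pcheckJ, List.all_eq_true] at h'
  have hc := h' rc hrc
  rw [Bool.and_eq_true, Bool.and_eq_true, Bool.and_eq_true, decide_eq_true_eq, decide_eq_true_eq,
    decide_eq_true_eq] at hc
  obtain ⟨⟨⟨h2, hσ⟩, hm⟩, hall⟩ := hc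
  have hE := expL_pdec odd rc t
  have hP := two_le_polesL_pdec h2 t
  refine Bool.and_eq_true_iff.2 ⟨Bool.and_eq_true_iff.2 ⟨?_, ?_⟩, ?_⟩
  · rw [Bool.or_eq_true, decide_eq_true_eq, decide_eq_true_eq]
    exact Or.inr (by rw [hE, hσ]; linarith)
  · have hne : decide (polesL (pdec t rc).1 = 1) = false := decide_eq_false (by omega)
    rw [hne]; rfl
  · rw [List.all_eq_true]
    intro tc' htc'
    obtain ⟨rc', hrc', rfl⟩ := List.mem_map.1 htc'
    rw [List.all_eq_true] at hall
    have hcc := hall rc' hrc'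
    have hc2 := h' rc' hrc'
    rw [Bool.and_eq_true, Bool.and_eq_true, Bool.and_eq_true, decide_eq_true_eq, decide_eq_true_eq,
      decide_eq_true_eq] at hc2
    obtain ⟨⟨⟨-, hσ'⟩, -⟩, -⟩ := hc2
    have hE' := expL_pdec odd rc' t
    simp only [Bool.or_eq_true, Bool.not_eq_true', decide_eq_false_iff_not] at hcc
    rcases hcc with (((hne | hne) | hd) | hd) | hs
    · have hx : decide (expL odd (pdec t rc).1 (pdec t rc).2 = m₀ + σ * t) = false :=
        decide_eq_false (by rw [hE, hσ]; intro hh; exact hne (by linarith))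
      simp only [pdec_fst, pdec_snd] at hx ⊢
      simp [hx]
    · have hx : decide (expL odd (pdec t rc').1 (pdec t rc').2 = m₀ + σ * t) = false :=
        decide_eq_false (by rw [hE', hσ']; intro hh; exact hne (by linarith))
      simp only [pdec_fst, pdec_snd] at hx ⊢
      simp [hx]
    · have hx := droppedL_pdec hd hσ t
      simp only [pdec_fst, pdec_snd] at hx ⊢
      simp [hx]
    · have hx := droppedL_pdec hd hσ' t
      simp only [pdec_fst, pdec_snd] at hx ⊢
      simp [hx]
    · have hx := sameTypeL_pdec hs t
      simp only [pdec_fst, pdec_snd] at hx ⊢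
      simp [hx]

/-- `t`-free form of `checkB` at `N₀ + νt`: every type multipole with sum slope `−ν`, `−N₀ ≤ E₀`, and the entries at base
level `−N₀` centre-free with mirror-symmetric run words. -/
def pcheckB (odd : Bool) (RC : List PRun) (ν N₀ : ℕ) : Bool :=
  RC.all fun rc => decide (2 ≤ rpoles0 rc.1) && decide (rslope rc.1 = -(ν : ℤ)) && decide (-(N₀ : ℤ) ≤ pexp0 odd rc) &&
    (!decide (pexp0 odd rc = -(N₀ : ℤ)) || (!rc.2 && decide (rc.1.reverse = rc.1)))

/-- **`checkB` (the double-drop guard) at every `t`.** -/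
theorem checkB_pdec {odd : Bool} {RC : List PRun} {ν N₀ : ℕ} (h : pcheckB odd RC ν N₀ = true) (t : ℕ) :
    checkB odd (RC.map (pdec t)) (N₀ + ν * t) = true := by
  rw [checkB, List.all_eq_true]
  intro tc htc
  obtain ⟨rc, hrc, rfl⟩ := List.mem_map.1 htc
  rw [pcheckB, List.all_eq_true] at h
  have hc := h rc hrc
  simp only [Bool.and_eq_true, Bool.or_eq_true, Bool.not_eq_true', decide_eq_true_eq, decide_eq_false_iff_not] at hc
  obtain ⟨⟨⟨h2, hσ⟩, hN⟩, hx⟩ := hc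
  have hE := expL_pdec odd rc t
  rw [hσ] at hE
  have hlt : decide (expL odd (pdec t rc).1 (pdec t rc).2 < -((N₀ + ν * t : ℕ) : ℤ)) = false :=
    decide_eq_false (by rw [hE]; push_cast; linarith)
  refine Bool.and_eq_true_iff.2 ⟨by rw [hlt]; rfl, ?_⟩
  rcases hx with hne | ⟨hc0, hrev⟩
  · have heq : decide (expL odd (pdec t rc).1 (pdec t rc).2 = -((N₀ + ν * t : ℕ) : ℤ)) = false :=
      decide_eq_false (by rw [hE]; push_cast; intro hh; exact hne (by linarith))
    rw [heq]; rfl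
  · have hpal : decide ((pdec t rc).1.reverse = (pdec t rc).1) = true := decide_eq_true (rdecode_palindrome hrev t)
    have hc1 : (pdec t rc).2 = false := hc0
    rw [hpal, hc1]; simp

/-- Run-word form of `sameKey`: equal centre flags and equal (or, off-centre, mirror-image) run words. -/
def psameKey (u v : Bool × List Run) : Bool :=
  decide (u.1 = v.1) && (decide (u.2 = v.2) || (!u.1 && decide (u.2 = v.2.reverse)))

/-- Rung-O keys with `psameKey` run data decode to `sameKey` keys at every `t`. -/
theorem sameKey_pdec {u v : Bool × List Run} (h : psameKey u v = true) (t : ℕ) :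
    sameKey (u.1, rdecode u.2 t) (v.1, rdecode v.2 t) = true := by
  simp only [psameKey, Bool.and_eq_true, Bool.or_eq_true, Bool.not_eq_true', decide_eq_true_eq] at h
  obtain ⟨hc, hR⟩ := h
  simp only [sameKey, Bool.and_eq_true, Bool.or_eq_true, Bool.not_eq_true', beq_iff_eq]
  refine ⟨hc, ?_⟩
  rcases hR with hR | ⟨h1, hR⟩
  · exact Or.inl (by rw [hR])
  · exact Or.inr ⟨h1, by rw [hR, ← rdecode_reverse]⟩

/-- `t`-free form of `checkO` at depth `N₀ + νt` with run-word keys: every type has sum slope `−ν`, `−N₀ ≤ E₀`, and a type AT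
`E₀ = −N₀` is `psameKey` to one of the two keys. -/
def pcheckO (odd : Bool) (RC : List PRun) (ν N₀ : ℕ) (K₁ K₂ : Bool × List Run) : Bool :=
  RC.all fun rc => decide (rslope rc.1 = -(ν : ℤ)) && decide (-(N₀ : ℤ) ≤ pexp0 odd rc) &&
    (!decide (pexp0 odd rc = -(N₀ : ℤ)) || (psameKey (rc.2, rc.1) K₁ || psameKey (rc.2, rc.1) K₂))

/-- **`checkO` (the collinearity rung's key check) at every `t`.** -/
theorem checkO_pdec {odd : Bool} {RC : List PRun} {ν N₀ : ℕ} {K₁ K₂ : Bool × List Run}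
    (h : pcheckO odd RC ν N₀ K₁ K₂ = true) (t : ℕ) :
    checkO odd (RC.map (pdec t)) (N₀ + ν * t) (K₁.1, rdecode K₁.2 t) (K₂.1, rdecode K₂.2 t) = true := by
  rw [checkO, List.all_eq_true]
  intro tc htc
  obtain ⟨rc, hrc, rfl⟩ := List.mem_map.1 htc
  rw [pcheckO, List.all_eq_true] at h
  have hc := h rc hrc
  simp only [Bool.and_eq_true, Bool.or_eq_true, Bool.not_eq_true', decide_eq_true_eq, decide_eq_false_iff_not] at hc
  obtain ⟨⟨hσ, hN⟩, hx⟩ := hc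
  have hE := expL_pdec odd rc t
  rw [hσ] at hE
  have hge : decide (-((N₀ + ν * t : ℕ) : ℤ) ≤ expL odd (pdec t rc).1 (pdec t rc).2) = true :=
    decide_eq_true (by rw [hE]; push_cast; linarith)
  refine Bool.and_eq_true_iff.2 ⟨hge, ?_⟩
  rw [Bool.or_eq_true]
  rcases hx with hne | hk
  · left
    have heq : decide (expL odd (pdec t rc).1 (pdec t rc).2 = -((N₀ + ν * t : ℕ) : ℤ)) = false :=
      decide_eq_false (by rw [hE]; push_cast; intro hh; exact hne (by linarith))
    rw [heq]; rfl
  · right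
    rw [Bool.or_eq_true, pdec_fst, pdec_snd]
    rcases hk with hk | hk
    · exact Or.inl (sameKey_pdec hk t)
    · exact Or.inr (sameKey_pdec hk t)

end Summit.KontsevichZagierPeriods.Zeta5Search.ClassTypeCover
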